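import Summits.BirchSwinnertonDyer.BirchSwinnertonDyer.Theorems.PublishedInputsGreenbergLemma34InflationCocycles
import Literature.NumberTheory.GaloisRepresentations.ContinuousCohomologyBockstein
import HarnessLib

set_option linter.dupNamespace false -- `…BirchSwinnertonDyer.BirchSwinnertonDyer…` is the cell's nested layout (D-0017)
set_option autoImplicit false

/-!
# Greenberg LNM 1716 Lemma 3.4 at `n = 0`: two cocycle lemmas along a `ℤ_p`-extension
# (a cocycle vanishing on `ker κE` and at the topological generator vanishes; values stay in a stable subgroup)

Seat `bsd-inputs-k4-p1` (gen 5; LADDER-BSD D-0154 KEY (147)(f) «prove the printed input», row 1 K4 INPUTS; Greenberg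
1999), `--supports stmt-BirchSwinnertonDyer-20309`. THEOREMS ONLY (no definition, no named fact, no `sorry`).

For a `ℤ_p`-extension `κE` of a field `E` of characteristic `0` with topological generator `g`, `ker κE` and `g`
generate `Γ_E` topologically (`ZpExtension.layerSubgroup_le_of_isOpen`). Hence, for a continuous cocycle `ψ` of a
discrete `Γ_E`-module:

* `contOneCocycles_eq_zero_of_apply_eq_zero` — if `ψ` vanishes on `ker κE` and at `g`, then `ψ = 0` (the zero locus
  `oneCocycleKer ψ` is an open subgroup);
* `contOneCocycles_apply_mem_of_apply_mem` — if `ψ` (valued in `E(K̄_E)`) vanishes on `ker κE` and `ψ(g)` lies in a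
  `Γ_E`-stable subgroup `A₁`, then every value of `ψ` lies in `A₁` (`{σ : ψ σ ∈ A₁}` is an open subgroup).

Used by the exact Kummer count for the formal group (`PublishedInputsGreenbergLemma34FormalKummer`).
HONEST FRAMING: bookkeeping; closes nothing; no summit statement is proved; BSD is not proved by any of this.

References: [SerreGaloisCohomology1997] I §2.2, I §5.1; [GreenbergLNM1716] §3 (pp. 86–89).
-/

noncomputable section

open scoped Classical

universe u

namespace Summit.BirchSwinnertonDyer.BirchSwinnertonDyer.Theorems.InputsGreenbergLemma34

open Field Literature.NumberTheory.EllipticCurves Literature.NumberTheory.GaloisRepresentations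
  Literature.NumberTheory.EllipticCurves.ZpExtension _root_.ContinuousCohomology WeierstrassCurve

variable {K : Type u} [Field K] (W : WeierstrassCurve K) (E : Type u) [Field E] [CharZero E] [Algebra K E]
  {p : ℕ} [hp : Fact p.Prime]

/-- **A continuous cocycle vanishing on `ker κE` and at a topological generator vanishes identically** (its zero locus
is an open subgroup containing both). [cite: SerreGaloisCohomology1997, I §2.2] -/
theorem contOneCocycles_eq_zero_of_apply_eq_zero (κE : ZpExtension E p) {g : absoluteGaloisGroup E}
    (hγ : κE.IsTopGenerator g) {M : Type u} [AddCommGroup M] [DistribMulAction (absoluteGaloisGroup E) M]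
    [TopologicalSpace M] [DiscreteTopology M]
    (ψ : contOneCocycles (discreteTopRep (absoluteGaloisGroup E) M))
    (hN : ∀ τ ∈ κE.kerSubgroup, ψ.1 τ = 0) (hg : ψ.1 g = 0) (σ : absoluteGaloisGroup E) : ψ.1 σ = 0 := by
  have hle : κE.layerSubgroup 0 ≤ oneCocycleKer ψ :=
    κE.layerSubgroup_le_of_isOpen hγ 0 (oneCocycleKer ψ) (isOpen_oneCocycleKer ψ)
      (fun τ hτ ↦ (mem_oneCocycleKer_iff ψ τ).mpr (hN τ hτ))
      ((mem_oneCocycleKer_iff ψ _).mpr (by rwa [pow_zero, pow_one]))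
  exact (mem_oneCocycleKer_iff ψ σ).mp (hle (by rw [layerSubgroup_zero]; exact Subgroup.mem_top σ))

/-- **A continuous cocycle vanishing on `ker κE` with value at the generator in a `Γ`-stable subgroup `A₁` takes all
its values in `A₁`** (`{σ : ψ σ ∈ A₁}` is an open subgroup containing both). [cite: SerreGaloisCohomology1997, I §2.2] -/
theorem contOneCocycles_apply_mem_of_apply_mem (κE : ZpExtension E p) {g : absoluteGaloisGroup E}
    (hγ : κE.IsTopGenerator g) (A₁ : AddSubgroup (localPoints W E))
    (hstab : ∀ (σ : absoluteGaloisGroup E) (a : localPoints W E), a ∈ A₁ → σ • a ∈ A₁)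
    (ψ : contOneCocycles (discreteTopRep (absoluteGaloisGroup E) (localPoints W E)))
    (hN : ∀ τ ∈ κE.kerSubgroup, ψ.1 τ = 0) (hg : ψ.1 g ∈ A₁) (σ : absoluteGaloisGroup E) : ψ.1 σ ∈ A₁ := by
  let U : Subgroup (absoluteGaloisGroup E) :=
    { carrier := {σ | ψ.1 σ ∈ A₁}
      one_mem' := by
        change ψ.1 1 ∈ A₁
        rw [contOneCocycles.apply_one]; exact A₁.zero_mem
      mul_mem' := fun {a b} ha hb ↦ by
        change ψ.1 (a * b) ∈ A₁
        have h := ψ.2 a b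
        change ψ.1 (a * b) = ψ.1 a + a • ψ.1 b at h
        rw [h]; exact A₁.add_mem ha (hstab a _ hb)
      inv_mem' := fun {a} ha ↦ by
        change ψ.1 a⁻¹ ∈ A₁
        have h := ψ.2 a⁻¹ a
        change ψ.1 (a⁻¹ * a) = ψ.1 a⁻¹ + a⁻¹ • ψ.1 a at h
        rw [inv_mul_cancel, contOneCocycles.apply_one] at h
        have e : ψ.1 a⁻¹ = -(a⁻¹ • ψ.1 a) := eq_neg_of_add_eq_zero_left h.symm
        rw [e]; exact A₁.neg_mem (hstab _ _ ha) }
  have hUo : IsOpen (U : Set (absoluteGaloisGroup E)) := by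
    change IsOpen (ψ.1 ⁻¹' (A₁ : Set (localPoints W E)))
    exact (isOpen_discrete _).preimage ψ.1.continuous
  have hle : κE.layerSubgroup 0 ≤ U :=
    κE.layerSubgroup_le_of_isOpen hγ 0 U hUo (fun τ hτ ↦ by
        change ψ.1 τ ∈ A₁
        rw [hN τ hτ]; exact A₁.zero_mem)
      (by change ψ.1 (g ^ p ^ 0) ∈ A₁; rwa [pow_zero, pow_one])
  exact hle (by rw [layerSubgroup_zero]; exact Subgroup.mem_top σ)

end Summit.BirchSwinnertonDyer.BirchSwinnertonDyer.Theorems.InputsGreenbergLemma34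

end
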